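import Summits.PneNP.GCT.Max.KYCannotSeparatePaddedPerUpToFive
import Summits.PneNP.GCT.Max.KYCannotSeparatePaddedPerSixFromEight
import Summits.PneNP.GCT.Max.KYCannotSeparatePaddedPerSevenFromTen
import Summits.PneNP.GCT.Max.KYCannotSeparatePaddedPerEightFromEleven
import HarnessLib
import HarnessLib.Audit

/-!
# `GCT/Max`: the plain Koszul–Young ceiling for padded permanents of size `m ≤ 8`, one statement
# (cell `pub-gct-max`, track F; theory-2 memo `FINDINGS-LT2.md` §2–§4c — capstone of the W2b chain)

For each `m ≤ 8` the tree now holds a threshold `n₀(m)` from which the plain Koszul–Young flattenings `Λ^p ⊗ S^k` ([LandsbergGCT2017] §8.2.1) are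
PROVED blind to the padded permanent `X₀₀^{n-m}·per_m` versus `det_n` at EVERY `n ≥ n₀(m)`:

  `n₀(m) = m + 1` for `m ≤ 5` (`Max/KYCannotSeparatePaddedPerUpToFive.lean` — conjecture C-F-2 of the memo holds for `m ≤ 5`),
  `n₀(6) = 8` (`Max/KYCannotSeparatePaddedPerSixFromEight.lean`), `n₀(7) = 10` (`Max/KYCannotSeparatePaddedPerSevenFromTen.lean`),
  `n₀(8) = 11` (`Max/KYCannotSeparatePaddedPerEightFromEleven.lean`).

This module packages them as ONE node on the threshold function `kyPaddedThreshold` (PROVED).  What is OPEN for this instrument in Lean: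
`(m,n) = (6,7)` (not reachable by leading-term counting at all: best order found gives target/bound `0.968⁻¹`), `(7,8)`, `(7,9)` (reachable by the
Bonferroni-2 device with ≈ 5 more kernel modules), `(8,9)`, `(8,10)` (reachable likewise); every `m ≥ 9` beyond the every-`m` ceiling `3m+2 ≤ 2n` of
`Max/KYSharperEveryM.lean` except what the one-family tables give for free.

HONEST FRAMING: a LOCATED NEGATIVE about ONE family of equations at explicit sizes, assembled from the tree; for every `(m,n)` covered with
`n < m²/2` separation is KNOWN in print ([LandsbergManivelRessayre2013] Thm. 1.0.1), so this delimits an instrument, not `per` versus `det`; it says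
nothing about other Young flattenings, border apolarity or multiplicity obstructions, nor about `dc(per_m)`, VP vs VNP or P vs NP; occurrence
obstructions are ruled out in print (BIP'16); no census row moves.  Theory-2 gen 28. [folklore]
-/

namespace Summit.PneNP.GCT

open Literature.Computability.AlgebraicComplexity Literature.Barriers.ValiantsHypothesis

/-- The proved blindness threshold `n₀(m)` of the plain Koszul–Young flattenings on `X₀₀^{n-m}·per_m` (`m ≤ 8`): `m+1` for `m ≤ 5`, then `8, 10, 11`
for `m = 6, 7, 8` (for `m ≥ 9` the value `m+1` is a placeholder — nothing is claimed there by this module). [folklore] -/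
def kyPaddedThreshold (m : ℕ) : ℕ :=
  if m = 6 then 8 else if m = 7 then 10 else if m = 8 then 11 else m + 1

/-- `GCT/Max` node **KYCannotSeparatePaddedPerUpToEight**: for every `m ≤ 8`, every `n ≥ kyPaddedThreshold m` and every `(p,k)`,
`rank KY_{p,k}(X₀₀^{n-m}·per_m) ≤ rank KY_{p,k}(det_n)` over `ℂ`.  A statement of the cell (LOCATED NEGATIVE on one instrument), PROVED below from
the tree's nodes for `m ≤ 5`, `m = 6`, `m = 7`, `m = 8`. [folklore] -/
def KYCannotSeparatePaddedPerUpToEight : Prop :=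
  ∀ (m n : ℕ) [NeZero n], m ≤ 8 → kyPaddedThreshold m ≤ n → ∀ p k : ℕ,
    kyRank ℂ p k (paddedPerPoly ℂ m n) ≤ kyRank ℂ p k (detPoly (Fin n) ℂ)

/-- `KYCannotSeparatePaddedPerUpToEight` holds. [folklore] -/
theorem kyCannotSeparatePaddedPerUpToEight_holds : KYCannotSeparatePaddedPerUpToEight := by
  intro m n _ hm hn p k
  by_cases h6 : m = 6
  · subst h6
    have hn' : 8 ≤ n := by simpa [kyPaddedThreshold] using hn
    exact kyCannotSeparatePaddedPerSixFromEight_holds n hn' p k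
  by_cases h7 : m = 7
  · subst h7
    have hn' : 10 ≤ n := by simpa [kyPaddedThreshold] using hn
    exact kyCannotSeparatePaddedPerSevenFromTen_holds n hn' p k
  by_cases h8 : m = 8
  · subst h8
    have hn' : 11 ≤ n := by simpa [kyPaddedThreshold] using hn
    exact kyCannotSeparatePaddedPerEightFromEleven_holds n hn' p k
  · have hm5 : m ≤ 5 := by omega
    have hn' : m + 1 ≤ n := by simpa [kyPaddedThreshold, h6, h7, h8] using hn
    exact kyCannotSeparatePaddedPerUpToFive_holds m n hm5 hn' p k

end Summit.PneNP.GCT
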